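import Literature.MathematicalPhysics.QuantumFieldTheory.Balaban1983to89.Beta.RemainderChainLattice
import Literature.MathematicalPhysics.QuantumFieldTheory.Balaban1983to89.TreeLengthTorusGeometry
import Literature.MathematicalPhysics.QuantumFieldTheory.Balaban1983to89.B12Decay510Torus

/-!
# `Balaban1983to89.Beta.RemainderChainTorus` — the remainder chain (2.38) ⟹ (I.1.18) ⟹ (5.10) ⟹ (1.22) ON THE
PERIODIC CARRIER OF PRINT (tori T₁ with N·M sites per direction, cubes of side M indexed by (ℤ/N)^d, localization
domains = non-empty torus-face-connected families of cubes, d_j := the torus tree length, sites = torus points): the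
TORUS TWIN of `Beta.RemainderChainLattice.ChainL`, with the SAME four numbers `CondsL d c ℓ` and the SAME closed-formula
coefficient `remCoeffL d M c α₂ B₃` — cell DIVERGENCE (i) of `Beta.RemainderChainLattice` ("windows of ℤ^d with free
boundary, not the periodic tori of print — on BOTH sides") REMOVED at no cost in the constant table (β sub-cell row
BETA-an4 = the k-uniform remainder, unit `b2b-balaban-beta-an4` gen 8, journal claim AN4-CHAIN-TORUS (2); bookkeeping BY
NAME over `Beta.RemainderChainLattice` (an4 gen 7, GAPS C-an4-16, C-an4-18, C-an4-19, XREAD C-pv03-33), `Beta.RemainderChainKP` (an4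
gen 6, C-an4-14), `TreeLengthTorusGeometry` / `TreeLengthTorus` (pv22 gen 2: `TorusStep`, `tgeometry`, `tsys`, `torusTreeLen`; GAPS C-pv22g2-1, C-pv27-2), `B12Decay510Torus`
(an4 gen 8, claim AN4-CHAIN-TORUS (1): the (5.10) site geometry of the torus with its three leaves PROVED),
`Beta.RemainderChain`, `Beta.DriftRemainder`; nothing imported is modified).

HONEST FRAMING (cell `pub-balaban`, BETA-SPEC, verbatim): discharging `BetaPertH` makes Bałaban's UV stability
UNCONDITIONAL — a real constructive-QFT result; it is NOT the continuum limit and NOT the Clay problem.  (Glosses 1–3″ of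
`Beta.RemainderChainLattice` apply verbatim: «UNCONDITIONAL» in [Balaban1989LargeFieldII] p. 355's interval-hypothesis
sense only; «unconditional» = the `EventualForm` / `EndpointExistence` / `BetaPartialSumsLowerH` END statement modulo the
binders listed by name — never «Theorem 2 as printed», never continuum / mass gap / Clay.)  THIS MODULE DISCHARGES NOTHING
of Lemma 3, of the representation (2.13), of the restriction property of the spaces, of the [I] (4.4) seam or of the [I]
§§4–5 ANALYTIC leaves ((4.4)-analyticity, (4.35), the p. 282 minimizer decay, the limit (5.1)): every theorem is a
composition BY NAME of landed, imported-untouched modules; nothing about Bałaban's β-functions (1.22) is asserted.  Value =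
the row's constant table kernel-valued on the papers' OWN periodic carrier (audit cell `pub-balaban`, β sub-cell), NOT
summit progress.

ABSOLUTE RULE (cell, verbatim): no internally-minted statement may enter as a cited fact; every hypothesis is either
kernel-proved in this package or a verbatim quotation of a PUBLISHED theorem with page reference; the manuscripts under
audit are NOT citable for their own disputed steps.  Nothing below is cited as a fact; the `[cite: …]` tags point at the
printed display a theorem's conclusion has the SHAPE of, or at the printed CONTEXT of a hypothesis binder, exactly as in
`Beta.RemainderChainLattice`.

CITATION HEADER (lean-in-tree rule).  [II] = T. Bałaban, Commun. Math. Phys. **116** (1988) 1–22 [Balaban1988RG2Cluster]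
(cell paper B13).  [I] = T. Bałaban, Commun. Math. Phys. **109** (1987) 249–301 [Balaban1987RG1] (cell paper B12; PDF page =
journal page − 248).  NOTHING IS NEWLY QUOTED HERE: the fragments repeated in the docstrings below are the render-checked /
cross-read wordings carried by the imported modules — [II] Lemma 3 p. 20 with (2.38), p. 21 (2.39)–(2.41) with *"for κ
sufficiently large, and ε₁ sufficiently small"* and *"At first we assume that (1 − 10δ)½L = 1"*, (2.11)/(2.13) p. 14, p. 15,
(1.26) p. 8 (`B13`, `B13Resummation`, `Beta.RemainderChainKP`, `TreeLengthTorusGeometry`; GAPS C-pv15-2, C-pv18-3 / C-pv11-8,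
C-an4-14, C-pv27-2); [I] p. 251 *"a torus T obtained by the usual identification of boundary points of the cube …"*, §0 p. 257
(cubes of side M, d_j *"divided by M"*, *"with a sufficiently large constant κ"*), (4.4) p. 281, the B₃-sentence p. 282,
(4.35) p. 290, (4.37) p. 291, (5.1) p. 292 *"lim_{T₁^{(j)}↗Z⁴}"*, (5.10) p. 293 *"(e.g., δ₁ = 1/2min{δ₀, κM⁻¹})"*,
(1.20)–(1.22) p. 264 (`TreeLengthTorus`, `B12Decay510`, `B12Decay510Lattice`, `B12Decay510Torus`, `Beta.RemainderChain`;
C-pv22-4, C-b03g3-1, C-b03g3-2, C-pv13g2-5, C-pv13g2-7, C-pv14-25, C-an4-16).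

WHAT THE TREE HAD.  (a) `Beta.RemainderChainLattice` (an4 gen 7): the chain on WINDOWS B n ⊂ ℤ^d — [II] side
`B13Closing.WindowStep (B n)`, [I] side `B12Decay510Lattice.geomL (B n) M` — with the four numbers `CondsL d c ℓ`
{large, small, A₂, tree}, the closed formulas `deltaL`, `polConstL`, `remCoeffL`, and `ChainL.abs_beta1_le :
RemainderConst S γ (ε₁ · remCoeffL d M c α₂ B₃)`; its DIVERGENCE (i) recorded that the [II]-side torus carrier existed
(`TreeLengthTorusGeometry.TorusStep`, constants ν = 2d + 1, κ₀ = κ₀(4·2^d, 2d), K₀ = K₀(4·2^d, 2d), c₁ = 4·2^d —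
`tgeometry_consts`, the same as the window model's) but that NO (5.10) site geometry on the torus was in the tree.
(b) `B12Decay510Torus` (this claim, part (1)) supplies it: sites (ℤ/NM)^d, periodic ℓ¹ distance `pl1`, cubes `tcubeOf`,
dist(x, □) = `distCT`, the `SiteGeometry` `geomT d N M` over `(tcubeSys d N).toCubeCover`, and the three leaves PROVED with
the SAME numbers as the lattice module — `geomLeafT` (M·d, 3), `cubeSumLeafT` K₁(d, a), `treeLeafT` K₀(4·2^d, 2d) at rate
κ/2 ≥ κ₀(4·2^d, 2d) — plus the metric leaf `pl1_proj_zero_sub_proj_eventually` for an exhausting family N_n → ∞.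

WHAT THIS MODULE PROVES (compositions by name; zero `sorry`; no new constant, no new condition).
§1  THE LEAF LIST ON THE PERIODIC CARRIER `PolLeavesT d M P c ℓ α₂ B₃`: cube counts `N n → ∞` (with their `NeZero`
    witnesses as a field), torus step data `W n : TorusStep d (N n)`, `SpRestr` / `Repr213` over the constructed torus
    geometry, (2.38)_ℓ, the (4.4) seam (`emb`, `hemb`, `hcomp`), and the ANALYTIC [I] leaves only (`han`, `hrepr`, `hh`
    with dist(x, X) := the periodic ℓ¹ distance from the site to the nearest cube of X, `hlim` at the sites 0, z mod N_nM)
    — NO geometric field; `PolLeavesT.h118` (the (I.1.18)-leaf DERIVED on each torus, `RemainderChainKP.h118_linear_of_KP`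
    at `tgeometry d (N n)` under the SAME `CondsL d c ℓ`); `PolLeavesT.toPolLeaves : PolLeaves d P (remActivity c) α₂ B₃ κ
    δ₀ (M·d) 3 (K₀(4·2^d, 2d)) (K₁(d, δ₀/2))` (geometric leaves SUPPLIED: `geomLeafT`, `cubeSumLeafT`, `treeLeafT`,
    `pl1_proj_zero_sub_proj_eventually`); `PolLeavesT.decay510 : Decay510 P (A_rem · polConstL d M c α₂ B₃) (deltaL d M c)`.
§2  THE CHAIN `ChainT d M μ ν S γ c ℓ α₂ B₃` and `ChainT.abs_beta1_le : CondsL d c ℓ → R22gen ℓ → SignsL c α₂ B₃ → 0 < d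
    → RemainderConst S γ (ε₁ · remCoeffL d M c α₂ B₃)` — LITERALLY the conclusion of `ChainL.abs_beta1_le`;
    `ChainT.neg_le_beta1`; `ChainT.abs_beta1_le_four` (d = 4 numerals, = those of `ChainL.abs_beta1_le_four`);
    `ChainT.abs_beta1_le_of_thresholds` (the three thresholds of `RemainderChainLattice` §6, unchanged).
§3  The RULING (R10) END consumers BY NAME (`Beta.DriftRemainder` §4 at `RemainderConst` grade):
    `betaPartialSumsLowerH_of_telescope_chainT`, `endpointExistence_of_telescope_chainT` (`ε₁·K_rem,L ≤ b·log L`).  Every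
    consumer of `ChainL.abs_beta1_le` (the wall `Beta.ComposedRoad`, the co-lead `Beta.ConstRemainderConsumers` /
    `Beta.AveragedAFCarrier`, binders `(hrem : RemainderConst S γ₀ r)`) takes `ChainT.abs_beta1_le` with the same
    `r := ε₁ · remCoeffL d M c α₂ B₃` — the two carriers are interchangeable at every consumer.
CONSTANTS' k-DEPENDENCE (row deliverable, cell record `BETA/REMAINDER-BETA.md` §2): as for `ChainL` — ONE `c`, ONE ℓ, ONE
(α₂, B₃), ONE M serve every scale k, every history, every torus index n; `CondsL` and `remCoeffL` mention neither k, nor the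
history, nor γ, nor N_n: k-uniformity and volume-uniformity are SYNTACTIC.  That the printed objects satisfy the analytic
leaves with such constants is what print asserts display by display (REMAINDER-BETA §2) and is NOT proved here.

DIVERGENCE (recorded in the cell file).  REMOVED relative to `Beta.RemainderChainLattice` (i): the finite-volume
approximants are the TORI of print on BOTH sides ([II]: `TorusStep`, 𝐃_{k+1} = torus localization domains with wrap-around
walls, d_{k+1} = `torusTreeLen`; [I]: `B12Decay510Torus.geomT`, periodic distances), exhausting ℤ^d as N_n → ∞; the limit
(5.1) stays the hypothesis `hlim`.  KEPT: (ii) the ℓ¹ reading of ∣x − y∣ and dist(X, ·) (the printed example constant's M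
appears as M·d, δ₁ = ½min{δ₀, κ(Md)⁻¹}; c₁ = 3), whence the routing through `RemainderChain.PolLeaves` with slot M·d
rather than through `RemainderChainKP.ChainKP`; (iii) (4.35) as printed (r = 2 only).  RESIDUAL MODEL CHOICES of the
carrier (stated, not divergences of a printed display): the torus of p. 251 has 2L_μ/ξ sites per direction and M = L^m,
here any N_n ≥ 1 cubes of any side M ≥ 1; the cube count N_n is the family index's only datum (print's T₁^{(j)} ↗ Z^d
along j).

WHAT IS NOT HERE.  As in `Beta.RemainderChainLattice`: Lemma 3 itself, (2.13)/(I.1.7) for Bałaban's E^{(k+1)} and the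
p. 15 restriction property (`hrep`, `hsp`: binders over the constructed torus geometry; their concrete torus forms are
`TorusStep.spRestr` / `.repr213`), the [I] analytic leaves, the dictionary clause `beta1_eq`, the one-loop side, `BetaPertH`.
References (CONTEXT ONLY): [I] T. Bałaban, CMP 109 (1987) 249–301; [II] T. Bałaban, CMP 116 (1988) 1–22; R. Kotecký,
D. Preiss, CMP 103 (1986) 491–498; [B16] T. Bałaban, CMP 122 (1989) 355–392, p. 355.
-/

namespace Literature.MathematicalPhysics.QuantumFieldTheory.Balaban1983to89.Beta.RemainderChainTorus

open Literature.MathematicalPhysics.QuantumFieldTheory.Balaban1983to89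
open FlowStep DagBinding FlowStepRuns
open Literature.MathematicalPhysics.QuantumFieldTheory.Balaban1983to89.B13ScaleTransfer (Pt)
open Literature.MathematicalPhysics.QuantumFieldTheory.Balaban1983to89.B13Resummation (Geometry SpRestr Repr213)
open Literature.MathematicalPhysics.QuantumFieldTheory.Balaban1983to89.B12TreeDecay (kappa₀ K₀ K₀_pos)
open Literature.MathematicalPhysics.QuantumFieldTheory.Balaban1983to89.TreeLengthTorus
  (TPt TDom proj tsys tcubeSys torusTreeLen)
open Literature.MathematicalPhysics.QuantumFieldTheory.Balaban1983to89.TreeLengthTorusGeometry (TorusStep)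
open Literature.MathematicalPhysics.QuantumFieldTheory.Balaban1983to89.B12Decay510 (delta1 mixedDeriv)
open Literature.MathematicalPhysics.QuantumFieldTheory.Balaban1983to89.B12Decay510Window (K₁)
open Literature.MathematicalPhysics.QuantumFieldTheory.Balaban1983to89.B12Decay510Torus
  (pl1 distCT nearT geomT geomLeafT cubeSumLeafT treeLeafT pl1_proj_zero_sub_proj_eventually)
open Literature.MathematicalPhysics.QuantumFieldTheory.Balaban1983to89.Beta.RemainderChain
open Literature.MathematicalPhysics.QuantumFieldTheory.Balaban1983to89.Beta.RemainderChainKP (h118_linear_of_KP)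
open Literature.MathematicalPhysics.QuantumFieldTheory.Balaban1983to89.Beta.RemainderChainLattice
  (CondsL SignsL deltaL deltaL_pos polConstL remCoeffL eps1_mul_remCoeffL condsL_four_iff polConstL_four
    kappaThresholdL a2ThresholdL eps1ThresholdL)
open Literature.MathematicalPhysics.QuantumFieldTheory.Balaban1983to89.Beta.DriftRemainder
  (betaPartialSumsLowerH_of_telescope_remainderConst endpointExistence_of_telescope_remainderConst)
open Metric Filter Topology

noncomputable section

variable {d : ℕ}

/-! ## 1. The leaf list on the PERIODIC carrier: tori T₁ with N_n·M sites per direction, torus step data, torus sites -/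

/-- **THE LEAVES OF THE REMAINDER POLARIZATION ON THE PERIODIC CARRIER** (the torus twin of
`RemainderChainLattice.PolLeavesL`): for each index n of the exhausting family of TORI (the limit of [I] p. 264, (5.1)
p. 292: *"lim_{T₁^{(j)}↗Z⁴}"*) — the number `N n` of cubes per direction (`N n → ∞`); the [II]-side step data `W n` WITH
𝐃_{k+1} := the localization domains OF THE TORUS and d_{k+1} := the torus tree length (`TreeLengthTorusGeometry.TorusStep`,
unit pv22 gen 2, over the same unit's `TreeLengthTorus.tsys`), the restriction property of the spaces (p. 15) and the
representation (2.13) over the CONSTRUCTED polymer geometry of the torus `tgeometry d (N n)` (= `(W n).geom`; concrete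
torus forms `TorusStep.spRestr` / `.repr213`), Lemma 3's bound (2.38)_ℓ on the activities; the [I] (4.4) seam (`emb`, `hemb`,
`hcomp`); and the [I] §§4–5 ANALYTIC leaves at the resolution of print ON THE TORUS — sites = the points of the periodic
lattice with `N n · M` sites per direction, cubes of side M (`B12Decay510Torus`, same unit): analyticity on the α₂-ball,
the polarization terms as second derivatives ((4.35), `hrepr`), the minimizer decay `B₃e^{−δ₀ dist(x, X)}` with dist(x, X)
:= the PERIODIC ℓ¹ distance from the site to the nearest cube of X (p. 282, `hh`), and the limit (5.1) at the sites
0, z mod N_nM (`hlim`).  ONE `c`, ONE ℓ, ONE (α₂, B₃), ONE M for all n.  A HYPOTHESIS structure: nothing of it is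
discharged here; NO geometric hypothesis is left in it.  The normed-space structures of the external-field spaces and the
`NeZero (N n)` witnesses are FIELDS (no global instance is registered).
[cite: Balaban1988RG2Cluster, (2.38) p.20 and (2.13) p.14; Balaban1987RG1, (4.4) p.281, (4.35) p.290 and (5.1) p.292] -/
structure PolLeavesT (d M : ℕ) [NeZero M] (P : (Fin d → ℤ) → ℝ) (c : B13.Consts) (ℓ α₂ B₃ : ℝ) where
  N : ℕ → ℕ
  [hN : ∀ n, NeZero (N n)]
  hNlim : Tendsto N atTop atTop
  W : (n : ℕ) → TorusStep d (N n)
  hsp : ∀ n, SpRestr (W n).toStepData (W n).geom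
  hrep : ∀ n, Repr213 (W n).toStepData (W n).geom
  h238 : ∀ n, B13.Bound238With (W n).toStepData c ℓ
  Wn : ℕ → Type
  [instW : ∀ n, NormedAddCommGroup (Wn n)]
  [instWs : ∀ n, NormedSpace ℂ (Wn n)]
  EXn : (n : ℕ) → TDom d (N n) → Wn n → ℂ
  emb : (n : ℕ) → TDom d (N n) → Wn n → (W n).Φ
  hemb : ∀ n X, ∀ v ∈ ball (0 : Wn n) α₂, emb n X v ∈ (W n).sp2 X
  hcomp : ∀ n X v, EXn n X v = (W n).Ek1 X (emb n X v)
  hn : (n : ℕ) → TDom d (N n) → TPt d (N n * M) → Wn n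
  E2n : (n : ℕ) → TDom d (N n) → TPt d (N n * M) → TPt d (N n * M) → ℝ
  han : ∀ n X, AnalyticOnNhd ℂ (EXn n X) (ball 0 α₂)
  hrepr : ∀ n X x y, E2n n X x y = (mixedDeriv (EXn n X) (hn n X x) (hn n X y)).re
  hh : ∀ n X x, ‖hn n X x‖ ≤ B₃ * Real.exp (-c.δ₀ * distCT (N n) M x (nearT (M := M) x X))
  hlim : ∀ z, Tendsto (fun n => ∑ X : TDom d (N n), E2n n X (proj (N n * M) 0) (proj (N n * M) z)) atTop (𝓝 (P z))

/-- **The (I.1.18)-leaf DERIVED on torus n** (`RemainderChainKP.h118_linear_of_KP` at the constructed torus geometry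
`tgeometry d (N n)`, whose constants ν = 2d + 1, κ₀ = κ₀(4·2^d, 2d), K₀ = K₀(4·2^d, 2d), c₁ = 4·2^d coincide with the
window model's — `TreeLengthTorusGeometry.tgeometry_consts`): Lemma 3's (2.38)_ℓ, `(1 − 10δ)ℓ = 1`, `C₃ε₁ ≥ 0` and the
SAME four numbers `CondsL d c ℓ` give `‖E^{(k+1)}(X, emb v)‖ ≤ A_rem e^{−κ·d_{k+1}(X)}` on the α₂-ball, d_{k+1} the torus
tree length. [cite: Balaban1988RG2Cluster, (2.38) p.20 and (2.41) p.21] -/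
theorem PolLeavesT.h118 {M : ℕ} [NeZero M] {P : (Fin d → ℤ) → ℝ} {c : B13.Consts} {ℓ α₂ B₃ : ℝ}
    (Lv : PolLeavesT d M P c ℓ α₂ B₃) (hC : CondsL d c ℓ) (h22 : c.R22gen ℓ) (hA : 0 ≤ c.C3act * c.ε₁) (n : ℕ) :
    letI := Lv.instW n
    letI := Lv.hN
    ∀ X, ∀ v ∈ ball (0 : Lv.Wn n) α₂, ‖Lv.EXn n X v‖ ≤ remActivity c * Real.exp (-c.κ * torusTreeLen X.1) := by
  letI := Lv.instW n
  letI := Lv.hN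
  exact h118_linear_of_KP (Lv.W n).toStepData c ℓ (Lv.W n).geom (Lv.hsp n) (Lv.hrep n) (Lv.h238 n) h22 hA
    hC.kappa_pos.le hC.large hC.small hC.A₂ (Lv.emb n) (Lv.EXn n) (Lv.hemb n) (Lv.hcomp n)

/-- **The torus leaves give the leaves of `RemainderChain.PolLeaves`** with activity `A_rem = O(1)C₃ε₁`, rate κ and the
SAME slots (M′, c₁, K₀, K₁) = (M·d, 3, K₀(4·2^d, 2d), K₁(d, δ₀/2)) as the window/lattice carrier — the (I.1.18)-leaf
DERIVED, the geometry leaf, cube sum and tree sum PROVED ON THE TORUS (`B12Decay510Torus.geomLeafT`, `cubeSumLeafT`,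
`treeLeafT`), the metric leaf `hρ` = `B12Decay510Torus.pl1_proj_zero_sub_proj_eventually` (the embedding
z ↦ z mod N_nM is isometric at (0, z) once N_n·M > 2∣z∣, eventually since N_n → ∞); the analytic leaves carried over
verbatim. [cite: Balaban1987RG1, (4.37) p.291 and (5.10) p.293; Balaban1988RG2Cluster, (2.38) p.20] -/
def PolLeavesT.toPolLeaves {M : ℕ} [NeZero M] {P : (Fin d → ℤ) → ℝ} {c : B13.Consts} {ℓ α₂ B₃ : ℝ}
    (Lv : PolLeavesT d M P c ℓ α₂ B₃) (hC : CondsL d c ℓ) (h22 : c.R22gen ℓ) (hs : SignsL c α₂ B₃) :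
    PolLeaves d P (remActivity c) α₂ B₃ c.κ c.δ₀ ((M : ℝ) * d) 3 (K₀ (4 * 2 ^ d) (2 * d)) (K₁ d (c.δ₀ / 2)) :=
  letI := Lv.hN
  { Sn := fun n => tsys d (Lv.N n)
    Cn := fun n => (tcubeSys d (Lv.N n)).toCubeCover
    Λn := fun n => TPt d (Lv.N n * M)
    Gn := fun n => geomT d (Lv.N n) M
    ρn := fun _ x y => pl1 (x - y)
    Wn := Lv.Wn
    instW := Lv.instW
    instWs := Lv.instWs
    EXn := Lv.EXn
    hn := Lv.hn
    E2n := Lv.E2n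
    e := fun n z => proj (Lv.N n * M) z
    han := Lv.han
    h118 := fun n => Lv.h118 hC h22 hs.A n
    hrepr := Lv.hrepr
    hh := Lv.hh
    hgeo := fun n => geomLeafT d (Lv.N n) M
    hcube := fun n => cubeSumLeafT d (Lv.N n) M (half_pos hs.δ₀_pos)
    htree := fun n => treeLeafT d (Lv.N n) hC.tree
    hρ := pl1_proj_zero_sub_proj_eventually Lv.N Lv.hNlim
    hlim := Lv.hlim }

/-- **(L2)–(L3) on the periodic carrier**: the torus leaves give the (5.10)-decay of the limit kernel
`|P(x)| ≤ A_rem · K_Π,L · e^{−δ₁|x|₁}`, `δ₁ = ½ min{δ₀, κ(Md)⁻¹}`, with NO geometric hypothesis and with the SAME constants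
`polConstL`, `deltaL` as on the window/lattice carrier (`RemainderChain.PolLeaves.decay510` ∘ `toPolLeaves`;
= `B12Decay510Torus.decay510_torus` with E₀ := A_rem). [cite: Balaban1987RG1, (5.10) p.293] -/
theorem PolLeavesT.decay510 {M : ℕ} [NeZero M] {P : (Fin d → ℤ) → ℝ} {c : B13.Consts} {ℓ α₂ B₃ : ℝ}
    (Lv : PolLeavesT d M P c ℓ α₂ B₃) (hC : CondsL d c ℓ) (h22 : c.R22gen ℓ) (hs : SignsL c α₂ B₃) (hd : 0 < d) :
    B12Sec2to5.Decay510 P (remActivity c * polConstL d M c α₂ B₃) (deltaL d M c) :=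
  (Lv.toPolLeaves hC h22 hs).decay510 hs.α₂_pos (hC.remActivity_nonneg hs.A) hs.B₃_nonneg (K₀_pos _ _).le
    hs.δ₀_pos.le hC.kappa_pos.le (mul_pos (Nat.cast_pos.2 (Nat.pos_of_neZero M)) (Nat.cast_pos.2 hd))

/-! ## 2. The chain on the periodic carrier and the k-UNIFORM bound — the SAME fully valued coefficient -/

/-- **THE REMAINDER CHAIN ON THE PERIODIC CARRIER** for the β-family `β` with one-loop split `S` on the boxes
`]0,γ]^{k+1}` (the torus twin of `RemainderChainLattice.ChainL`): `P1 k p` = the `T ↗ ℤ^d` limit polarization kernel of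
the (2.13)-half at scale k + 1 and history p; `beta1_eq` = the dictionary clause ((1.20)/(1.22) applied to that half);
`leaves k p hp` = the torus leaf list with THE SAME `c, ℓ, α₂, B₃, M` for every k and every history.  A HYPOTHESIS
structure. [cite: Balaban1987RG1, (1.20)-(1.22) p.264; Balaban1988RG2Cluster, (2.38) p.20] -/
structure ChainT (d M : ℕ) [NeZero M] (μ ν : Fin d) {β : HBeta} (S : B12Beta.OneLoopSplit β) (γ : ℝ) (c : B13.Consts)
    (ℓ α₂ B₃ : ℝ) where
  P1 : (k : ℕ) → (Fin (k + 1) → ℝ) → B12Beta.Kernel d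
  beta1_eq : ∀ k p, p ∈ B12Beta.HistBox γ k → S.β1 k p = B12Beta.secondMoment (P1 k p) μ ν
  leaves : ∀ k p, p ∈ B12Beta.HistBox γ k → PolLeavesT d M (P1 k p μ ν) c ℓ α₂ B₃

/-- **THE k-UNIFORM REMAINDER BOUND ON THE PERIODIC CARRIER, coefficient FULLY VALUED AND IDENTICAL TO THE WINDOW
CARRIER'S**: a torus chain with the four numeric conditions `CondsL d c ℓ`, `(1 − 10δ)ℓ = 1` and the printed signs gives
`|β¹_{k+1}(g_0,…,g_k)| ≤ ε₁ · K_rem,L` for EVERY scale k and EVERY history in `]0,γ]^{k+1}`, with the SAME closed formula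
`K_rem,L = RemainderChainLattice.remCoeffL d M c α₂ B₃` as `ChainL.abs_beta1_le` — passing from windows of ℤ^d to the tori
of print costs nothing in the constant table.  O(ε₁), not O(g_k), not O(γ²).
[cite: Balaban1988RG2Cluster, (2.38) p.20; Balaban1987RG1, (5.10) p.293 and (1.22) p.264] -/
theorem ChainT.abs_beta1_le {M : ℕ} [NeZero M] {μ ν : Fin d} {β : HBeta} {S : B12Beta.OneLoopSplit β} {γ : ℝ}
    {c : B13.Consts} {ℓ α₂ B₃ : ℝ} (R : ChainT d M μ ν S γ c ℓ α₂ B₃) (hC : CondsL d c ℓ) (h22 : c.R22gen ℓ)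
    (hs : SignsL c α₂ B₃) (hd : 0 < d) : RemainderConst S γ (c.ε₁ * remCoeffL d M c α₂ B₃) := by
  intro k p hp
  have hδ₁ : 0 < deltaL d M c := deltaL_pos hC hs.δ₀_pos hd (Nat.pos_of_neZero M)
  have hdec := (R.leaves k p hp).decay510 hC h22 hs hd
  rw [R.beta1_eq k p hp, eps1_mul_remCoeffL]
  exact abs_secondMoment_le_linear hδ₁ hdec

/-- The one-sided form `−ε₁K_rem,L ≤ β¹_{k+1}` on the boxes (the binder shape of RULING (R10)'s remainder slot). [folklore] -/
theorem ChainT.neg_le_beta1 {M : ℕ} [NeZero M] {μ ν : Fin d} {β : HBeta} {S : B12Beta.OneLoopSplit β} {γ : ℝ}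
    {c : B13.Consts} {ℓ α₂ B₃ : ℝ} (R : ChainT d M μ ν S γ c ℓ α₂ B₃) (hC : CondsL d c ℓ) (h22 : c.R22gen ℓ)
    (hs : SignsL c α₂ B₃) (hd : 0 < d) :
    ∀ k (p : Fin (k + 1) → ℝ), p ∈ B12Beta.HistBox γ k → -(c.ε₁ * remCoeffL d M c α₂ B₃) ≤ S.β1 k p :=
  fun k p hp => (abs_le.mp (R.abs_beta1_le hC h22 hs hd k p hp)).1

/-- d = 4: the bound reads `|β¹_{k+1}| ≤ ε₁ · A₂ · C₃ · 4α₂⁻²B₃² e^{12Mδ₁} K₀(64,8) K₁(4,δ₀/2) · Σ_{x∈ℤ⁴}|x|₁²e^{−δ₁|x|₁}`,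
`δ₁ = ½ min{δ₀, κ(4M)⁻¹}`, under the numeral conditions of `RemainderChainLattice.condsL_four_iff` — numerals identical
to `ChainL.abs_beta1_le_four`. [cite: Balaban1987RG1, (5.10) p.293 and (1.22) p.264] -/
theorem ChainT.abs_beta1_le_four {M : ℕ} [NeZero M] {μ ν : Fin 4} {β : HBeta} {S : B12Beta.OneLoopSplit β} {γ : ℝ}
    {c : B13.Consts} {ℓ α₂ B₃ : ℝ} (R : ChainT 4 M μ ν S γ c ℓ α₂ B₃)
    (hlarge : c.κ + 2 * (64 * Real.log 162) + 2 ≤ (1 - 8 * c.δ) * ℓ * c.κ)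
    (hsmall : c.C3act * c.ε₁ * Real.exp (5 * c.κ + 1) * K₀ 64 8 * 9 * 64 ≤ 1)
    (hA₂ : Real.exp 1 * 9 * 64 * K₀ 64 8 ^ 2 ≤ c.A₂) (htree : 128 * Real.log 162 ≤ c.κ) (h22 : c.R22gen ℓ)
    (hs : SignsL c α₂ B₃) :
    RemainderConst S γ (c.ε₁ * (c.A₂ * c.C3act *
      B12Sec2to5.betaPrime510 4 (4 / α₂ ^ 2 * B₃ ^ 2 * Real.exp (12 * (M : ℝ) * delta1 c.δ₀ c.κ (4 * (M : ℝ))) *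
        K₀ 64 8 * K₁ 4 (c.δ₀ / 2)) (delta1 c.δ₀ c.κ (4 * (M : ℝ))))) := by
  have hC : CondsL 4 c ℓ := (condsL_four_iff c ℓ).2 ⟨hlarge, hsmall, hA₂, htree⟩
  obtain ⟨hδ, hK⟩ := polConstL_four M c α₂ B₃
  have h := R.abs_beta1_le hC h22 hs (by norm_num)
  rw [remCoeffL, hK, hδ] at h
  exact h

/-- **The (2.38)-grade k-uniform constant on the torus from the three thresholds of `RemainderChainLattice` §6**
(`ChainT.abs_beta1_le` ∘ `CondsL.of_thresholds`): κ ≥ `kappaThresholdL d ℓ`, A₂ ≥ `a2ThresholdL d`, C₃ε₁ ≤ `eps1ThresholdL d κ`.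
[cite: Balaban1988RG2Cluster, Lemma 3 (2.38) p.20 and p.21; Balaban1987RG1, (5.10) p.293, (1.20)–(1.22) p.264] -/
theorem ChainT.abs_beta1_le_of_thresholds {M : ℕ} [NeZero M] {μ ν : Fin d} {β : HBeta} {S : B12Beta.OneLoopSplit β}
    {γ : ℝ} {c : B13.Consts} {ℓ α₂ B₃ : ℝ} (R : ChainT d M μ ν S γ c ℓ α₂ B₃) (h22 : c.R22gen ℓ) (hℓ : 1 < ℓ)
    (hκ : kappaThresholdL d ℓ ≤ c.κ) (hA : a2ThresholdL d ≤ c.A₂) (hε : c.C3act * c.ε₁ ≤ eps1ThresholdL d c.κ)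
    (hs : SignsL c α₂ B₃) (hd : 0 < d) : RemainderConst S γ (c.ε₁ * remCoeffL d M c α₂ B₃) :=
  R.abs_beta1_le (CondsL.of_thresholds c h22 hℓ hκ hA hε) h22 hs hd

/-! ## 3. The RULING (R10) END consumers, by name -/

/-- **`BetaPartialSumsLowerH` from telescoping + the torus chain**
(`Beta.DriftRemainder.betaPartialSumsLowerH_of_telescope_remainderConst` ∘ `ChainT.abs_beta1_le`): (T1) `Σ_{j<k} β⁰_j = B(L^k)`,
(T2) `|B(n) − b log n| ≤ A` (n ≥ 2), the chain, and the printed-type restriction `ε₁·K_rem,L ≤ b·log L` give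
`BetaPartialSumsLowerH (2A) γ₀ β`. [cite: Balaban1987RG1, Thm 2 p.259 (first sentence); Balaban1988RG2Cluster, (2.38) p.20] -/
theorem betaPartialSumsLowerH_of_telescope_chainT {M : ℕ} [NeZero M] {μ ν : Fin d} {β : HBeta}
    {S : B12Beta.OneLoopSplit β} {γ₀ : ℝ} {c : B13.Consts} {ℓ α₂ B₃ b A : ℝ} {B : ℕ → ℝ} {L : ℕ}
    (R : ChainT d M μ ν S γ₀ c ℓ α₂ B₃) (hC : CondsL d c ℓ) (h22 : c.R22gen ℓ) (hs : SignsL c α₂ B₃) (hd : 0 < d)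
    (hL : 2 ≤ L) (hA : 0 ≤ A) (hTel : ∀ k : ℕ, ∑ j ∈ Finset.range k, S.β0 j = B (L ^ k))
    (hB : ∀ n : ℕ, 2 ≤ n → |B n - b * Real.log n| ≤ A) (hε₁ : c.ε₁ * remCoeffL d M c α₂ B₃ ≤ b * Real.log L) :
    BetaPartialSumsLowerH (2 * A) γ₀ β :=
  betaPartialSumsLowerH_of_telescope_remainderConst S hL hA hTel hB (R.abs_beta1_le hC h22 hs hd) hε₁

/-- **ENDPOINT EXISTENCE from telescoping + the torus chain** ([I] Thm 2 first sentence for forward-generated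
constructions; `Beta.DriftRemainder.endpointExistence_of_telescope_remainderConst` ∘ `ChainT.abs_beta1_le`).
[cite: Balaban1987RG1, Thm 2 p.259 (first sentence); Balaban1988RG2Cluster, (2.38) p.20] -/
theorem endpointExistence_of_telescope_chainT {C : B12.Construction} {β : HBeta} (hgen : ForwardGenerated C β)
    {S : B12Beta.OneLoopSplit β} {M : ℕ} [NeZero M] {μ ν : Fin d} {c : B13.Consts} {ℓ α₂ B₃ γ₀ b A β' : ℝ}
    {B : ℕ → ℝ} {L : ℕ} (R : ChainT d M μ ν S γ₀ c ℓ α₂ B₃) (hC : CondsL d c ℓ) (h22 : c.R22gen ℓ)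
    (hs : SignsL c α₂ B₃) (hd : 0 < d) (hγ₀ : 0 < γ₀) (hL : 2 ≤ L) (hA : 0 ≤ A)
    (hTel : ∀ k : ℕ, ∑ j ∈ Finset.range k, S.β0 j = B (L ^ k))
    (hB : ∀ n : ℕ, 2 ≤ n → |B n - b * Real.log n| ≤ A)
    (hε₁ : c.ε₁ * remCoeffL d M c α₂ B₃ ≤ b * Real.log L) (hβ' : 0 ≤ β') (hcont : BetaContH γ₀ β)
    (hup : BetaUpperH β' γ₀ β) : EndpointExistence C :=
  endpointExistence_of_telescope_remainderConst hgen S hγ₀ hL hA hTel hB (R.abs_beta1_le hC h22 hs hd) hε₁ hβ' hcont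
    hup

end

end Literature.MathematicalPhysics.QuantumFieldTheory.Balaban1983to89.Beta.RemainderChainTorus
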